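import Summits.QuantumFields.YangMills.Theorems.BalabanUVNodesN15KingModelTheorem21Package
import Summits.QuantumFields.YangMills.Theorems.BalabanUVNodesN15KingModelTwoPointFiniteKInfiniteVolume

/-!
# BalabanUVNodes ∕ N15 — THE KING-MODEL RUNG (PART Ϝ, final package): KING's THEOREM 2.1 FOR THE FREE FIELD AND THE BLOCK-SMEARED TWO-POINT FUNCTION FROM FINITE TORI
# AT FIXED `ε_K` TO THE INFINITE-VOLUME CONTINUUM, BY NAME IN ONE CONJUNCTION
# (Track A, DAG node N15 = NE2; FAN-OUT v1.1 §N15 s3 «KING-MODEL RUNG … NE2's analogue DECIDED in the model»)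

HONEST FRAMING.  Count-neutral (cell `pub-ymgap`, seat `pub-ymgap-dag-n15-e` g33; `--supports stmt-QuantumFields-27366 --as helper` = K3⁸
`SpineGivenEndpointR13SepCoPHV`).  TEMPLATE LITERATURE: C. King, *The U(1) Higgs model. I. The continuum limit*, Commun. Math. Phys. **102** (1986) 649–677
[King1986] — KING's OWN `A = 0`, `g = 0` MODEL.  Assembly of parts Ϝ-a…Ϝ-p (files `…KingModelFineFieldGeneratingFunctional` … `…TwoPointFiniteKInfiniteVolume`) BY NAME;
nothing new is proved.  NOT the interacting U(1) Higgs model; NOT Bałaban's objects; NOT a node discharge (N15 is booked through n15-a's knit, untouched here); nothing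
continuum-Yang–Mills ∕ ℝ⁴ ∕ OS ∕ mass-gap ∕ Clay.  0 `sorry`; standard axioms; 0 `def`.

WHAT THIS FILE PROVES (kernel).  ★★★ **`king_partDigamma_package`**: for odd `L ≥ 2`, `a, m² > 0`: (1) `Thm21Printed` for the free fine-lattice functionals at unit-block
sources (every bound `H`), (2) for the RG block-field functionals, (3) for sources constant on the `ε_{k₀}`-blocks (every `k₀`); (4) the `ε_K²` rate of (2.22); (5) the
two-point square of limits (fixed volume `K → ∞`; then volume; fixed `K` volume limit; then `K`; joint) to `S₂^{ℝ}`; (6) infinite-volume exponential clustering of `S₂^{ℝ}`;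
(7) `Σ_z S₂^{ℝ}(z) = m⁻²`; (8) positive-definiteness of `S₂^{ℝ}`; (9) at every `K ≥ 1`: `Σ_z V_{L^K}(z) = m⁻²`.

HONEST SCOPE.  As in the parts.  N15 untouched; counts unmoved.  Locators: [King1986] Thm 2.1 (2.22)–(2.23) p.654, (2.13)–(2.15) p.653, (2.20) p.654, Thm 3.3 (3.6) p.655,
(4.5) p.670, Lemma 4.5 (4.38) p.674.
-/

noncomputable section

open scoped BigOperators
open Finset Filter Topology

namespace Summit.QuantumFields.YangMills.BalabanUVNodes.N15KingModelRung

open Literature.MathematicalPhysics.QuantumFieldTheory.Balaban1983to89.B5Prop11Plancherel (Tor fine)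
open Literature.MathematicalPhysics.QuantumFieldTheory.King1986 (aK)
open Literature.MathematicalPhysics.QuantumFieldTheory.King1986.Torus
open Literature.MathematicalPhysics.QuantumFieldTheory.King1986.ContinuumLimit (eps Torus221 Thm21Printed)

variable {d : ℕ}

/-- ★★★ **PART Ϝ IN ONE CONJUNCTION** (odd `L ≥ 2`, `a, m² > 0`, `H`, `k₀`, `z ∈ ℤ^{d+1}`): King's Theorem 2.1 by name for the free field (three source classes), the rate, the
two-point square of limits, and the infinite-volume structure (decay, susceptibility `m⁻²` at `K = ∞` and at every finite `K ≥ 1`, positivity).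
[cite: King1986, Thm 2.1 (2.22)–(2.23) p.654, Lemma 4.5 (4.38) p.674, Thm 3.3 (3.6) p.655] -/
theorem king_partDigamma_package (L : ℕ) (hLodd : Odd L) (hL : 2 ≤ L) {a m2 : ℝ} (ha : 0 < a) (hm : 0 < m2) (H : ℝ) (k₀ : ℕ) (z : Fin (d + 1) → ℤ) :
    haveI : NeZero L := ⟨by omega⟩
    -- (1)–(3) Theorem 2.1 by name
    (∀ J : ∀ T : Torus221 (d + 1), Tor (t221Sites T) → ℝ, (∀ T b, |J T b| ≤ H) → Thm21Printed (kingFreeZ L m2 J))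
    ∧ (∀ J : ∀ T : Torus221 (d + 1), Tor (t221Sites T) → ℝ, (∀ T b, |J T b| ≤ H) → Thm21Printed (kingBlockZ L a m2 J))
    ∧ (∀ J : ∀ T : Torus221 (d + 1), Tor (fine (L ^ k₀) (t221Sites T)) → ℝ, (∀ T b, |J T b| ≤ H) → Thm21Printed (kingFreeZlev L m2 k₀ J))
    -- (4) the rate of (2.22)
    ∧ (∀ J : ∀ T : Torus221 (d + 1), Tor (t221Sites T) → ℝ, (∀ T b, |J T b| ≤ H) → ∀ T : Torus221 (d + 1), ∀ K : ℕ, 1 ≤ K →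
        |Real.log (kingFreeZ L m2 J T K) - Real.log (kingFreeZlim m2 J T)| ≤ symbolRateConst 1 L m2 * H ^ 2 / 2 * T.vol * eps L K ^ 2)
    -- (5) the square of limits for the two-point function (cubic tori for the volume limits)
    ∧ ((∀ (M : Fin (d + 1) → ℕ) [∀ ν, NeZero (M ν)] (b b' : Tor M), Tendsto (fun K : ℕ => kingS2 (L ^ K) M m2 b b') atTop (𝓝 (kingS2Lim M m2 b b')))
      ∧ Tendsto (fun k : ℕ => kingS2Lim (fun _ : Fin (d + 1) => k + 1) m2 0 (fun ν => ((z ν : ℤ) : ZMod (k + 1)))) atTop (𝓝 (kingS2Inf m2 z))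
      ∧ (∀ K : ℕ, 1 ≤ K → Tendsto (fun k : ℕ => kingS2 (L ^ K) (fun _ : Fin (d + 1) => k + 1) m2 0 (fun ν => ((z ν : ℤ) : ZMod (k + 1)))) atTop
          (𝓝 (kingS2InfK (L ^ K) m2 z)))
      ∧ Tendsto (fun K : ℕ => kingS2InfK (L ^ K) m2 z) atTop (𝓝 (kingS2Inf m2 z))
      ∧ Tendsto (fun k : ℕ => kingS2 (L ^ (k + 1)) (fun _ : Fin (d + 1) => k + 1) m2 0 (fun ν => ((z ν : ℤ) : ZMod (k + 1)))) atTop (𝓝 (kingS2Inf m2 z)))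
    -- (6)–(8) infinite volume: clustering, susceptibility, positivity
    ∧ (z ≠ 0 → ∀ ν, |kingS2Inf m2 z| ≤ 2 / gamM a m2 L * Real.exp (-(kapM (d + 1) a m2 L * |(z ν : ℝ)|)))
    ∧ ∑' w : Fin (d + 1) → ℤ, kingS2Inf m2 w = m2⁻¹
    ∧ (∀ (s : Finset (Fin (d + 1) → ℤ)) (c : (Fin (d + 1) → ℤ) → ℝ), 0 ≤ ∑ w ∈ s, ∑ w' ∈ s, c w * kingS2Inf m2 (w' - w) * c w')
    -- (9) finite-`K` infinite volume: susceptibility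
    ∧ (∀ K : ℕ, 1 ≤ K → ∑' w : Fin (d + 1) → ℤ, kingS2InfK (L ^ K) m2 w = m2⁻¹) := by
  haveI : NeZero L := ⟨by omega⟩
  obtain ⟨h1, h2, h3, h4, -, -, -⟩ := king_thm21_freeField_package (d := d) L a m2 hLodd hL ha hm H k₀
  refine ⟨h1, h2, h3, h4, ?_, fun hz ν => abs_kingS2Inf_le_decay L hLodd hL ha hm hz ν, tsum_kingS2Inf_eq_inv_mass hm,
    fun s c => kingS2Inf_posSemidef hm s c, fun K hK => tsum_kingS2InfK_eq_inv_mass L hLodd hL hm hK⟩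
  have h := king_twoPoint_limits_package L hLodd hL hm z
  exact h

end Summit.QuantumFields.YangMills.BalabanUVNodes.N15KingModelRung

end
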